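import Literature.Computability.AlgebraicComplexity.ApproximativeRootClosure
import Literature.Computability.AlgebraicComplexity.BorderComplexityZariski
import HarnessLib

/-!
# Presentable border complexity: the classes `\overline{VP}_ε`, `\overline{VNP}_ε`
# (Bhargav–Dwivedi–Saxena 2024, §1.2 and §4)

Topic `Computability/AlgebraicComplexity`. C. S. Bhargav, P. Dwivedi, N. Saxena, *Learning the
coefficients: a presentable version of border complexity and applications to circuit factoring*,
STOC 2024, 130–140, doi:10.1145/3618260.3649743 (held text `paper:doi-10-1145-3618260-3649743`,
pp. 4–7, 13–14, 16); the two definitions are quoted from the survey P. Dutta, V. Lysikov, *Recent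
advances in debordering methods*, arXiv:2510.13049, Def. 48 / Def. 49 / Thm. 50 (held p. 17), which
restates them verbatim (the boxed displays of the STOC version did not survive text extraction).

PRESENTABILITY (BDS §1.2, p. 5): "The presentable class `\overline{VP}_ε` is the same as
`\overline{VP}` but with the additional condition that all the polynomials in `ε` used as
'constants' in the approximating circuit `g(x, ε)` have polynomial-size circuits themselves";
Def. 48: "`(f_n) ∈ \overline{VP}_ε` over `F` if there is an approximating polynomial
`g_n ∈ F[ε][x]` satisfying `g_n(x, ε) = ε^M · f_n(x) + ε^{M+1} · S_n(x, ε)` for some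
`S_n ∈ F[ε][x]` and `M ∈ ℕ`", with `size_F(g_n)` (the circuit size of `g_n` OVER `F`, `ε` an input
variable) polynomially bounded; Def. 49 (`\overline{VNP}_ε`): the same with `g_n(x, ε) =
Σ_{a ∈ {0,1}^m} h_n(x, a, ε)` for a "verifier polynomial" `h_n ∈ F[x, y_1 … y_m, ε]` with `m` and
`size_F(h_n)` polynomially bounded. "Crucially … we do not restrict the degree of `ε`, which could
be exponential in `size_F(h)`" (p. 5). "It is easy to see that `VNP ⊆ \overline{VNP}_ε ⊆
\overline{VNP}` … Similarly, the containment `VP ⊆ \overline{VP}_ε ⊆ \overline{VP}` raises new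
questions" (p. 5); "it is apparent from the definitions that `VP ⊆ \overline{VP}_ε ⊆
\overline{VNP}_ε`" (p. 14).

RENDERING. The tree's border currency is `F((ε))[x_σ]` with "`= O(ε^k)` coefficientwise"
(`PolyOrdGE`, file `LaurentPolyOrder`; `borderComplexity`, file `ApproximativeRootClosure`). A
presentation of `f ∈ F[x_σ]` to order `M` is a polynomial `G ∈ F[x_σ, ε]` — the variable type
`Option σ`, `none` playing `ε` — such that `ε^{-M} · G(x, ε) - f = O(ε)` in `F((ε))[x_σ]`
(`Presents M G f`); since `G` is a polynomial in `ε` this says exactly `G = ε^M f + ε^{M+1} S` with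
`S ∈ F[ε][x]`. `presBorderComplexity f` is the least `size_F(G)` (the tree's `complexity`, fan-in
two, constants of `F` free) over all presentations, and `\overline{VP}_ε` / `\overline{VNP}_ε` are
the family predicates `IsPresVPBarFamily` / `IsPresVNPBarFamily` (p-bounded presentable border
complexity, resp. a p-bounded Boolean sum of a presented verifier), used — like the tree's
`IsVPBarFamily` — together with the separate p-family hypothesis `IsPFamily f` (p-bounded number of
variables and degree of the LIMIT `f_n`). Def. 48 as quoted by Dutta–Lysikov also bounds the
`x`-degree of the approximant `g_n`; for a p-family `f` this is no restriction up to a factor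
`O(deg(f_n)²)` in size (keep only the `x`-homogeneous parts of `g_n` of degree `≤ deg f_n`, gate by
gate, `ε` having `x`-degree `0` — valid over every field), so the present rendering defines the
same classes; it is not used below.

## Main results

* `Presents`, `presBorderComplexity`, `IsPresVPBarFamily`, `PresentsSum`, `IsPresVNPBarFamily` —
  the definitions (BDS Def. 4.3 = Dutta–Lysikov Def. 48, 49).
* `presents_zero_rename_some`, `presBorderComplexity_le_complexity` — `VP ⊆ \overline{VP}_ε`
  (`L_ε(f) ≤ L(f)`: present `f` by itself, `M = 0`).
* `borderComplexity_le_presBorderComplexity_add_one` — `\overline{VP}_ε ⊆ \overline{VP}` in the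
  `ε`-rendering (`L̲(f) ≤ L_ε(f) + 1`: substitute the Laurent variable for `ε` and multiply by the
  free constant `ε^{-M}`), and over `ℂ` `IsPresVPBarFamily.isVPBarFamily` (BLMW's Zariski
  rendering, via `approxComplexity_le_borderComplexity`).
* `IsPresVPBarFamily.isPresVNPBarFamily` — `\overline{VP}_ε ⊆ \overline{VNP}_ε` (empty Boolean sum).
* NAMED FACTS (unproved here, `def … : Prop` with the print locator): `BDS2024_thm_1_3`
  ("Presentable is explicit": over a finite field `\overline{VNP}_ε = VNP`, Thm. 1.3 = DL Thm. 50 —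
  the non-trivial inclusion), `BDS2024_lemma_4_4` (separable low-degree factors of small circuits
  are in `\overline{VP}_ε`, Lemma 4.4, after Bürgisser 2004 Thm. 1.3).
* `PresVNPBarSubsetVNP F` — the STATEMENT "`\overline{VNP}_ε ⊆ VNP` over `F`" as a neutral
  proposition: a theorem for finite `F` (Thm. 1.3), an OPEN QUESTION over `ℚ` ("remains open over
  `ℚ`; due to the possibility of doubly-exponentially large integers appearing", p. 16) — recorded,
  not asserted; `presVNPBarSubsetVNP_of_thm_1_3` unfolds the fact.
* `BDS2024.cor_1_5_of_facts` — Cor. 1.5 (separable low-degree factors of small circuits over a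
  finite field are in `VNP`) as the kernel composition Lemma 4.4 + (`\overline{VP}_ε ⊆
  \overline{VNP}_ε`) + Thm. 1.3, exactly as printed (p. 14, proof of Cor. 1.5).

Honest framing: definitions, three elementary inclusions and two named facts of a 2024 STOC paper;
nothing here bears on `VP ≠ VNP`, and the facts are hypotheses `(h : BDS2024_thm_1_3 F)`, never
axioms. No instances, no notation.

## References

* C. S. Bhargav, P. Dwivedi, N. Saxena, *Learning the coefficients: a presentable version of border
  complexity and applications to circuit factoring*, STOC 2024, doi:10.1145/3618260.3649743, §1.2
  (p. 5), Thm. 1.3, Cor. 1.5 (p. 6), §4 Def. 4.3, Lemma 4.4 (pp. 13–14), §6 (p. 16).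
  [BhargavDwivediSaxena2024]
* P. Dutta, V. Lysikov, *Recent advances in debordering methods*, arXiv:2510.13049 (2025), §3.4
  Def. 48, Def. 49, Thm. 50. [arXiv:2510.13049]
* P. Bürgisser, *The complexity of factors of multivariate polynomials*, Found. Comput. Math. 4
  (2004), Def. 2.1, Thm. 1.3. [Burgisser2004Factors]
-/

noncomputable section

open MvPolynomial

universe u v

namespace Literature.Computability.AlgebraicComplexity

section Presentable

variable {F : Type u} [Field F] {σ : Type v}

/-- The substitution reading a polynomial `G ∈ F[x_σ, ε]` (variable type `Option σ`, `none` = `ε`)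
inside `F((ε))[x_σ]`: `ε ↦` the Laurent variable `HahnSeries.single 1 1`, `x_i ↦ x_i`.
[cite: BhargavDwivediSaxena2024, Def. 4.3 (§1.2 p. 5: "ε-polynomials used as constants")] -/
def epsSubst (F : Type u) [Field F] (σ : Type v) : Option σ → MvPolynomial σ (LaurentSeries F) :=
  fun o => o.elim (C (HahnSeries.single (1 : ℤ) (1 : F))) X

/-- **`G` presents `f` to order `M`** (BDS 2024 Def. 4.3 / Dutta–Lysikov Def. 48: `g(x, ε) =
ε^M · f(x) + ε^{M+1} · S(x, ε)` with `g ∈ F[ε][x]`), rendered in `F((ε))[x_σ]` as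
`ε^{-M} · G(x, ε) - f = O(ε)` coefficientwise. [cite: BhargavDwivediSaxena2024, Def. 4.3] -/
def Presents (M : ℕ) (G : MvPolynomial (Option σ) F) (f : MvPolynomial σ F) : Prop :=
  PolyOrdGE 1 (C (HahnSeries.single (-(M : ℤ)) (1 : F)) *
      aeval (epsSubst F σ) (MvPolynomial.map (algebraMap F (LaurentSeries F)) G) -
    MvPolynomial.map (algebraMap F (LaurentSeries F)) f)

/-- **Presentable border complexity `L_ε(f)`**: the least circuit size OVER `F` (`ε` an input,
constants of `F` free; the tree's `complexity`) of a polynomial `G ∈ F[x_σ, ε]` presenting `f` to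
some order `M` — the size parameter "`size_F(g)`" of BDS 2024 Def. 4.3. The set is non-empty
(`presents_zero_rename_some`). [cite: BhargavDwivediSaxena2024, Def. 4.3] -/
def presBorderComplexity (f : MvPolynomial σ F) : ℕ :=
  sInf {s | ∃ (M : ℕ) (G : MvPolynomial (Option σ) F), complexity G ≤ s ∧ Presents M G f}

/-- `f` (renamed into `F[x_σ, ε]`, not using `ε`) presents itself to order `0`.
[cite: BhargavDwivediSaxena2024, §1.2 (p. 5: VP ⊆ \overline{VP}_ε)] -/
theorem presents_zero_rename_some (f : MvPolynomial σ F) : Presents 0 (rename some f) f := by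
  unfold Presents
  have hθ : (epsSubst F σ) ∘ some = X := funext fun _ => rfl
  rw [Nat.cast_zero, neg_zero, HahnSeries.single_zero_one, map_one, one_mul, map_rename,
    aeval_rename, hθ, aeval_X_left_apply, sub_self]
  exact PolyOrdGE.zero 1

/-- **`VP ⊆ \overline{VP}_ε` at the level of measures: `L_ε(f) ≤ L(f)`.**
[cite: BhargavDwivediSaxena2024, §1.2 (p. 5) and §4.1 (p. 14)] -/
theorem presBorderComplexity_le_complexity (f : MvPolynomial σ F) :
    presBorderComplexity f ≤ complexity f := by
  apply Nat.sInf_le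
  exact ⟨0, rename some f, complexity_rename_le_holds' some f, presents_zero_rename_some f⟩

/-- The infimum is attained: a presentation of size `≤ L_ε(f)` exists.
[cite: BhargavDwivediSaxena2024, Def. 4.3] -/
theorem exists_presents_complexity_le (f : MvPolynomial σ F) :
    ∃ (M : ℕ) (G : MvPolynomial (Option σ) F), complexity G ≤ presBorderComplexity f ∧
      Presents M G f := by
  have hne : {s | ∃ (M : ℕ) (G : MvPolynomial (Option σ) F), complexity G ≤ s ∧
      Presents M G f}.Nonempty :=
    ⟨complexity f, 0, rename some f, complexity_rename_le_holds' some f,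
      presents_zero_rename_some f⟩
  exact Nat.sInf_mem hne

/-- `L_ε(f) ≤ s` iff some presentation of size `≤ s` exists. [cite: BhargavDwivediSaxena2024, Def. 4.3] -/
theorem presBorderComplexity_le_iff (f : MvPolynomial σ F) (s : ℕ) :
    presBorderComplexity f ≤ s ↔
      ∃ (M : ℕ) (G : MvPolynomial (Option σ) F), complexity G ≤ s ∧ Presents M G f := by
  constructor
  · intro hs
    obtain ⟨M, G, hc, hP⟩ := exists_presents_complexity_le f
    exact ⟨M, G, hc.trans hs, hP⟩
  · rintro ⟨M, G, hc, hP⟩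
    refine le_trans (Nat.sInf_le ?_) hc
    exact ⟨M, G, le_rfl, hP⟩

/-- The border computation `ε^{-M} · G(x, ε) ∈ F((ε))[x_σ]` extracted from a presentation costs at
most one gate more than `G` over the field of constants `F((ε))` (the `ε`-powers are free there).
[cite: BhargavDwivediSaxena2024, §1.1 (p. 4: "arbitrary polynomials in ε are treated as free constants")] -/
theorem complexity_epsShift_aeval_le [Fintype σ] (G : MvPolynomial (Option σ) F)
    (c : LaurentSeries F) :
    complexity (C c * aeval (epsSubst F σ) (MvPolynomial.map (algebraMap F (LaurentSeries F)) G)) ≤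
      complexity G + 1 := by
  have hsum : ∑ o : Option σ, complexity (epsSubst F σ o) = 0 :=
    Finset.sum_eq_zero fun o _ => by
      cases o with
      | none => exact complexity_C_holds _
      | some i => exact complexity_X_holds _
  calc complexity (C c * aeval (epsSubst F σ) (MvPolynomial.map (algebraMap F (LaurentSeries F)) G))
      ≤ complexity (C c : MvPolynomial σ (LaurentSeries F)) +
          complexity (aeval (epsSubst F σ)
            (MvPolynomial.map (algebraMap F (LaurentSeries F)) G)) + 1 :=
        complexity_mul_le_holds _ _
    _ ≤ 0 + (complexity G + 0) + 1 := by
        refine Nat.add_le_add_right (add_le_add (complexity_C_holds _).le ?_) 1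
        refine (complexity_aeval_le _ _).trans ?_
        rw [hsum]
        exact Nat.add_le_add_right (ArithCircuit.complexity_map_le _ G) 0
    _ = complexity G + 1 := by omega

/-- **`\overline{VP}_ε ⊆ \overline{VP}` at the level of measures: `L̲(f) ≤ L_ε(f) + 1`** (a
presentation IS a border computation once `ε` is read as the Laurent variable and the output is
multiplied by the free constant `ε^{-M}`). [cite: BhargavDwivediSaxena2024, §1.2 (p. 5: \overline{VP}_ε ⊆ \overline{VP})] -/
theorem borderComplexity_le_presBorderComplexity_add_one [Fintype σ] (f : MvPolynomial σ F) :
    borderComplexity f ≤ presBorderComplexity f + 1 := by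
  obtain ⟨M, G, hc, hP⟩ := exists_presents_complexity_le f
  exact (borderComplexity_le_of_polyOrdGE _ hP).trans
    ((complexity_epsShift_aeval_le G _).trans (Nat.add_le_add_right hc 1))

/-- **`H` presents `f` to order `M` through a Boolean sum** (BDS 2024 §1.2 / Dutta–Lysikov
Def. 49: `Σ_{a ∈ {0,1}^m} h(x, a, ε) = g(x, ε) = ε^M · f + ε^{M+1} · S`), rendered in
`F((ε))[x_σ]`: `ε^{-M} · Σ_a H(x, a, ε) - f = O(ε)`. [cite: BhargavDwivediSaxena2024, §1.2 (p. 5, size parameters (m, size_F(h)))] -/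
def PresentsSum (M : ℕ) {m : ℕ} (H : MvPolynomial (Option (σ ⊕ Fin m)) F)
    (f : MvPolynomial σ F) : Prop :=
  PolyOrdGE 1 (C (HahnSeries.single (-(M : ℤ)) (1 : F)) *
      boolSum (aeval (epsSubst F (σ ⊕ Fin m))
        (MvPolynomial.map (algebraMap F (LaurentSeries F)) H)) -
    MvPolynomial.map (algebraMap F (LaurentSeries F)) f)

end Presentable

section Families

variable {F : Type u} [Field F] {ς : ℕ → Type v}

/-- **`\overline{VP}_ε`** as a family predicate: `L_ε(f_n)` is p-bounded (used, like the tree's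
`IsVPBarFamily`, together with the p-family hypothesis `IsPFamily f`).
[cite: BhargavDwivediSaxena2024, Def. 4.3] -/
def IsPresVPBarFamily (f : ∀ n, MvPolynomial (ς n) F) : Prop :=
  IsPBounded fun n => presBorderComplexity (f n)

/-- **`\overline{VNP}_ε`** as a family predicate: a presentation of `f_n` through a Boolean sum of
length `u n` of a verifier `H_n ∈ F[x, y, ε]`, with `u` and `size_F(H_n)` p-bounded ("the pair
`(m, size_F(h))` constitutes the size parameters", p. 5). [cite: BhargavDwivediSaxena2024, §1.2 (p. 5)] -/
def IsPresVNPBarFamily (f : ∀ n, MvPolynomial (ς n) F) : Prop :=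
  ∃ (u M : ℕ → ℕ) (H : ∀ n, MvPolynomial (Option (ς n ⊕ Fin (u n))) F),
    IsPBounded u ∧ (IsPBounded fun n => complexity (H n)) ∧ ∀ n, PresentsSum (M n) (H n) (f n)

/-- `VP ⊆ \overline{VP}_ε` for families: a p-computable family is presentable (by itself).
[cite: BhargavDwivediSaxena2024, §1.2 (p. 5)] -/
theorem IsPresVPBarFamily.of_isPComputable {f : ∀ n, MvPolynomial (ς n) F}
    (hf : IsPComputable f) : IsPresVPBarFamily f :=
  hf.mono fun n => presBorderComplexity_le_complexity (f n)

/-- `\overline{VP}_ε ⊆ \overline{VP}` for families over `ℂ`, in BLMW's Zariski rendering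
(`IsVPBarFamily`): `\underline{L}(f_n) ≤ L̲(f_n) ≤ L_ε(f_n) + 1`.
[cite: BhargavDwivediSaxena2024, §1.2 (p. 5: \overline{VP}_ε ⊆ \overline{VP})] -/
theorem IsPresVPBarFamily.isVPBarFamily {ς : ℕ → Type v} [∀ n, Fintype (ς n)]
    [∀ n, DecidableEq (ς n)] {f : ∀ n, MvPolynomial (ς n) ℂ} (hf : IsPresVPBarFamily f) :
    IsVPBarFamily f :=
  (hf.add_holds (IsPBounded.const 1)).mono fun n =>
    (approxComplexity_le_borderComplexity (f n)).trans
      (borderComplexity_le_presBorderComplexity_add_one (f n))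

/-- A presentation is a presentation through the EMPTY Boolean sum (`m = 0`).
[cite: BhargavDwivediSaxena2024, §4.1 (p. 14: \overline{VP}_ε ⊆ \overline{VNP}_ε by definition)] -/
theorem presentsSum_rename_of_presents {σ : Type v} {M : ℕ} {G : MvPolynomial (Option σ) F}
    {f : MvPolynomial σ F} (hP : Presents M G f) :
    PresentsSum M (rename (Option.map (Sum.inl : σ → σ ⊕ Fin 0)) G) f := by
  unfold PresentsSum
  have hbs : boolSum (aeval (epsSubst F (σ ⊕ Fin 0))
      (MvPolynomial.map (algebraMap F (LaurentSeries F))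
        (rename (Option.map (Sum.inl : σ → σ ⊕ Fin 0)) G))) =
      aeval (epsSubst F σ) (MvPolynomial.map (algebraMap F (LaurentSeries F)) G) := by
    unfold boolSum
    rw [Fintype.sum_unique, map_rename, aeval_rename, ← AlgHom.comp_apply]
    refine DFunLike.congr_fun (MvPolynomial.algHom_ext fun o => ?_) _
    rw [AlgHom.comp_apply, aeval_X, aeval_X]
    cases o with
    | none =>
        show aeval _ (C (HahnSeries.single (1 : ℤ) (1 : F))) =
          (C (HahnSeries.single (1 : ℤ) (1 : F)) : MvPolynomial σ (LaurentSeries F))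
        exact MvPolynomial.algHom_C _ _
    | some i =>
        show aeval _ (X (Sum.inl i) : MvPolynomial (σ ⊕ Fin 0) (LaurentSeries F)) =
          (X i : MvPolynomial σ (LaurentSeries F))
        rw [aeval_X, Sum.elim_inl]
  rw [hbs]
  exact hP

/-- **`\overline{VP}_ε ⊆ \overline{VNP}_ε`** for families ("apparent from the definitions", p. 14).
[cite: BhargavDwivediSaxena2024, §4.1 (p. 14)] -/
theorem IsPresVPBarFamily.isPresVNPBarFamily {f : ∀ n, MvPolynomial (ς n) F}
    (hf : IsPresVPBarFamily f) : IsPresVNPBarFamily f := by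
  choose M G hc hP using fun n => exists_presents_complexity_le (f n)
  refine ⟨fun _ => 0, M, fun n => rename (Option.map Sum.inl) (G n), IsPBounded.const 0,
    hf.mono fun n => (complexity_rename_le_holds' _ (G n)).trans (hc n), fun n => ?_⟩
  exact presentsSum_rename_of_presents (hP n)

/-- The STATEMENT "`\overline{VNP}_ε ⊆ VNP` over `F`" (for p-families on the variable sets
`Fin (v n)`): a THEOREM over finite fields (BDS 2024 Thm. 1.3, the named fact `BDS2024_thm_1_3`),
an OPEN QUESTION over `ℚ` — "The question whether `\overline{VNP}_ε` is contained in `VNP`,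
remains open over `ℚ`; due to the possibility of doubly-exponentially large integers appearing"
(p. 16) — and not discussed in print over `ℂ`. Recorded as a proposition, asserted for no field.
[cite: BhargavDwivediSaxena2024, Thm. 1.3 and §6 (p. 16)] -/
def PresVNPBarSubsetVNP (F : Type u) [Field F] : Prop :=
  ∀ (v : ℕ → ℕ) (f : ∀ n, MvPolynomial (Fin (v n)) F),
    IsPFamily f → IsPresVNPBarFamily f → IsVNPFamily f

/-- The STATEMENT "`\overline{VP}_ε ⊆ VNP` over `F`" (p-families): implied by
`PresVNPBarSubsetVNP F` (`presVPBarSubsetVNP_of_presVNPBarSubsetVNP`); over finite fields a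
theorem (Thm. 1.3), in characteristic zero open ("we do not even know whether `\overline{VP}` is
contained in `VNP`", p. 5, is the question one level up). [cite: BhargavDwivediSaxena2024, §1.2 (p. 5) and Thm. 1.3] -/
def PresVPBarSubsetVNP (F : Type u) [Field F] : Prop :=
  ∀ (v : ℕ → ℕ) (f : ∀ n, MvPolynomial (Fin (v n)) F),
    IsPFamily f → IsPresVPBarFamily f → IsVNPFamily f

/-- `\overline{VNP}_ε ⊆ VNP` gives `\overline{VP}_ε ⊆ VNP`. [cite: BhargavDwivediSaxena2024, §4.1 (p. 14, proof of Cor. 1.5)] -/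
theorem presVPBarSubsetVNP_of_presVNPBarSubsetVNP {F : Type u} [Field F]
    (h : PresVNPBarSubsetVNP F) : PresVPBarSubsetVNP F :=
  fun v f hpf hf => h v f hpf hf.isPresVNPBarFamily

/-- **BDS 2024, Thm. 1.3 — "Presentable is explicit" (NAMED FACT):** over a finite field,
`\overline{VNP}_ε = VNP`; vendored as the non-trivial inclusion `\overline{VNP}_ε ⊆ VNP` for
p-families (the inclusion `VNP ⊆ \overline{VNP}_ε` is definitional). Proof in print: exponential
interpolation at roots of unity of large order (Lemma 4.1), Boolean simulation of `F_{q^m}`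
arithmetic (Lemma 4.2), Valiant's criterion (Prop. 2.1). Dutta–Lysikov Thm. 50.
[cite: BhargavDwivediSaxena2024, Thm. 1.3] -/
def BDS2024_thm_1_3 (F : Type u) [Field F] [Finite F] : Prop :=
  PresVNPBarSubsetVNP F

/-- Unfolding the fact. [cite: BhargavDwivediSaxena2024, Thm. 1.3] -/
theorem presVNPBarSubsetVNP_of_thm_1_3 {F : Type u} [Field F] [Finite F]
    (h : BDS2024_thm_1_3 F) : PresVNPBarSubsetVNP F := h

/-- **BDS 2024, Lemma 4.4 (NAMED FACT; after Bürgisser 2004 Thm. 1.3 and the remark following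
his Def. 2.1):** "Consider a polynomial (family) `g ∈ F_q[x_1 … x_n]` satisfying `g = f^e h`,
where `f` is irreducible and coprime to `h`, [`e` coprime to the characteristic,] such that
`size(g)` and `deg(f)` is at most poly. Then we have `f` in `\overline{VP}_ε`" — "over the field
of characteristic zero the result will hold for all the low-degree factors" (p. 14). Rendered for
families on `Fin (v n)` over any field: separability as `(e n : F) ≠ 0`, coprimality as
`IsRelPrime`, "size(g) poly" as `IsPComputable g`, "deg(f) poly (and `n` variables)" as
`IsPFamily f`. Proof in the full version of the source (its ref. [4]).
[cite: BhargavDwivediSaxena2024, Lemma 4.4] -/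
def BDS2024_lemma_4_4 (F : Type u) [Field F] : Prop :=
  ∀ (v e : ℕ → ℕ) (f g h : ∀ n, MvPolynomial (Fin (v n)) F),
    (∀ n, g n = f n ^ e n * h n) → (∀ n, Irreducible (f n)) → (∀ n, IsRelPrime (f n) (h n)) →
    (∀ n, ((e n : ℕ) : F) ≠ 0) → IsPComputable g → IsPFamily f → IsPresVPBarFamily f

namespace BDS2024

/-- **BDS 2024, Cor. 1.5 (debordering factors), from the two facts exactly as printed** (p. 14:
"We learn from Lemma 4.4 that `f ∈ \overline{VP}_ε`. Moreover `\overline{VP}_ε` is contained in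
`\overline{VNP}_ε` by definition. As over `F_q`, Theorem 1.3 proves `\overline{VNP}_ε = VNP`,
hence `f ∈ VNP`"): over a finite field, a separable irreducible low-degree factor of a family of
small circuits is p-definable. [cite: BhargavDwivediSaxena2024, Cor. 1.5] -/
theorem cor_1_5_of_facts {F : Type u} [Field F] [Finite F] (h44 : BDS2024_lemma_4_4 F)
    (h13 : BDS2024_thm_1_3 F) (v e : ℕ → ℕ) (f g h : ∀ n, MvPolynomial (Fin (v n)) F)
    (hfac : ∀ n, g n = f n ^ e n * h n) (hirr : ∀ n, Irreducible (f n))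
    (hcop : ∀ n, IsRelPrime (f n) (h n)) (hsep : ∀ n, ((e n : ℕ) : F) ≠ 0)
    (hg : IsPComputable g) (hf : IsPFamily f) : IsVNPFamily f :=
  presVPBarSubsetVNP_of_presVNPBarSubsetVNP h13 v f hf (h44 v e f g h hfac hirr hcop hsep hg hf)

end BDS2024

end Families

end Literature.Computability.AlgebraicComplexity

end
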